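import Literature.Geometry.Lorentzian.KerrBackwardsIsometry
import Literature.Geometry.Lorentzian.KerrRicciFlat
import Literature.Geometry.Lorentzian.KerrStarChartBounds
import HarnessLib

/-!
# KerrBackwardsIsometry — proofs

Discharge of the named fact `Literature.Geometry.Lorentzian.ONeill1995_kerrBackwardsIsometry`
(`KerrBackwardsIsometry.lean`; O'Neill, *The Geometry of Kerr Black Holes* (1995), Ch. 3, §3.1:
the backwards isometry `β : (r, ϑ, φ, t) ↦ (r, ϑ, −φ, −t)` of the Boyer–Lindquist exterior block,
read in the ingoing Kerr–Schild chart of the tree).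

| fact | status here |
|---|---|
| `ONeill1995_kerrBackwardsIsometry` | **PROVED**: `ONeill1995_kerrBackwardsIsometry_holds` |

## The map

In the ingoing Kerr coordinates `u = (t*, r, μ, φ)` of the tree's chart `Kerr.Ingoing.chart`
(`KerrIngoingCoordChart.lean`) the Boyer–Lindquist reflection `(t, φ) ↦ (−t, −φ)` reads
`ι̂(t*, r, μ, φ) = (−t* + F(r), r, μ, −φ + G(r))` with `F' = 4Mr/Δ`, `G' = 2a/Δ`,
`Δ = r² − 2Mr + a² = (r − r₊)(r − r₋)` (because `t* = t + (r* − r)`, `φ_* = φ + A(r)` with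
`(r* − r)' = 2Mr/Δ`, `A' = a/Δ`); explicitly `F = 2(t̄ − r)` and `G = 2φ̄` for the tree's Kerr-star shifts `Kerr.starTime`,
`Kerr.starAngle` (`KerrStarChartBounds.lean`), smooth on `r > r₊` for sub-extremal parameters.
The pulled-back Kerr–Schild form `Kerr.Ingoing.bilin` (`kerrBilin_jac`) is invariant under
`dι̂` by a rational identity (`Kerr.Ingoing.bilin_coordDeriv`). In Kerr–Schild Cartesian
coordinates, writing `x + iy = (r + ia) sin ϑ e^{iφ}` (`Kerr.kerrStar`), the same map is
`ι(t, x + iy, z) = (−t + F(r), e^{iG(r)} (r + ia)² (x − iy)/(r² + a²), z)` (`Kerr.Backwards.map`):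
explicit, `r`- and `z`-preserving, an involution, `C^∞` on the exterior, intertwined with `ι̂` by
the chart (`map_chartFun`), and with `ι(x + s ∂_{t*}) = ι(x) − s ∂_{t*}`. The isometry identity
`g_{ιx}(dι v, dι w) = g_x(v, w)` is transported through the chart at off-axis points (the Jacobian
of the chart is bijective there) and extended to the axis by continuity
(`Kerr.eqOn_region_of_offAxis`), as in the tree's proof of `Kerr.isRicciFlat`.

## References

* B. O'Neill, *The Geometry of Kerr Black Holes*, A K Peters (1995), Ch. 3, §3.1 (the backwards
  isometry `β`), Ch. 2, §2.5 (Kerr-star coordinates). [ONeill1995]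
* R. M. Wald, *General Relativity* (1984), §6.1 (time reflection of static space-times). [Wald1984]
* M. Visser, *The Kerr spacetime: a brief introduction*, arXiv:0706.0622, §4. [arXiv07060622]
-/

noncomputable section

set_option maxSynthPendingDepth 3

open Set Function Real Filter
open scoped Topology Manifold ContDiff

namespace Literature.Geometry.Lorentzian

namespace Kerr

namespace Backwards

/-! ## §1 The radial shifts `F = 2(t̄ − r)`, `G = 2φ̄` -/

variable {M a : ℝ}

/-- **The time shift** `F(r) = 2(t̄(r) − r)`, twice the difference between the Kerr-star time shift
`t̄` (`Kerr.starTime`, `dt̄/dr = (r² + a²)/Δ`) and `r`; a primitive of `4Mr/Δ` on `r > r₊`.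
O'Neill 1995, Ch. 2, §2.5 (`t* = t + T(r)`). [cite: ONeill1995, Ch. 2 §2.5] -/
def timeShift (M a r : ℝ) : ℝ := 2 * (starTime M a r - r)

/-- **The angle shift** `G(r) = 2φ̄(r)`, twice the Kerr-star angle shift (`Kerr.starAngle`,
`dφ̄/dr = a/Δ`); a primitive of `2a/Δ` on `r > r₊`. O'Neill 1995, Ch. 2, §2.5 (`φ* = φ + A(r)`).
[cite: ONeill1995, Ch. 2 §2.5] -/
def angleShift (M a r : ℝ) : ℝ := 2 * starAngle M a r

/-- `F' = 4Mr/Δ` on `r > r₊` (`2((r² + a²)/Δ − 1) = 4Mr/Δ`). [folklore] -/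
theorem hasDerivAt_timeShift (h : IsSubextremal M a) {r : ℝ} (hr : rPlus M a < r) :
    HasDerivAt (timeShift M a) (4 * M * r / delta M a r) r := by
  have hΔ : delta M a r ≠ 0 := (delta_pos h.le hr).ne'
  refine (((hasDerivAt_starTime h hr).sub (hasDerivAt_id r)).const_mul 2).congr_deriv ?_
  field_simp
  unfold delta
  ring

/-- `G' = 2a/Δ` on `r > r₊`. [folklore] -/
theorem hasDerivAt_angleShift (h : IsSubextremal M a) {r : ℝ} (hr : rPlus M a < r) :
    HasDerivAt (angleShift M a) (2 * a / delta M a r) r := by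
  refine ((hasDerivAt_starAngle h hr).const_mul 2).congr_deriv ?_
  ring

/-- `F` is smooth on `r > r₊`. [folklore] -/
theorem contDiffAt_timeShift (h : IsSubextremal M a) {r : ℝ} (hr : rPlus M a < r) {n : WithTop ℕ∞} :
    ContDiffAt ℝ n (timeShift M a) r :=
  contDiffAt_const.mul (((contDiffOn_starTime h).contDiffAt (Ioi_mem_nhds hr)).sub contDiffAt_id)

/-- `G` is smooth on `r > r₊`. [folklore] -/
theorem contDiffAt_angleShift (h : IsSubextremal M a) {r : ℝ} (hr : rPlus M a < r) {n : WithTop ℕ∞} :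
    ContDiffAt ℝ n (angleShift M a) r :=
  contDiffAt_const.mul ((contDiffOn_starAngle h).contDiffAt (Ioi_mem_nhds hr))

/-! ## §2 The map in ingoing Kerr coordinates and the invariance of the components -/

/-- **The backwards map in ingoing Kerr coordinates** `ι̂(t*, r, μ, φ) = (−t* + F(r), r, μ, −φ + G(r))`
(the Boyer–Lindquist reflection `(t, φ) ↦ (−t, −φ)` written in the ingoing coordinates
`t* = t + (r* − r)`, `φ_* = φ + A(r)`). O'Neill 1995, Ch. 3, §3.1. [cite: ONeill1995, Ch. 3 §3.1] -/
def coordMap (M a : ℝ) (u : E4) : E4 :=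
  !₂[-u 0 + timeShift M a (u 1), u 1, u 2, -u 3 + angleShift M a (u 1)]

/-- Component `t*` of `ι̂`. [folklore] -/
@[simp] theorem coordMap_apply_zero (u : E4) : coordMap M a u 0 = -u 0 + timeShift M a (u 1) := rfl
/-- Component `r` of `ι̂`. [folklore] -/
@[simp] theorem coordMap_apply_one (u : E4) : coordMap M a u 1 = u 1 := rfl
/-- Component `μ` of `ι̂`. [folklore] -/
@[simp] theorem coordMap_apply_two (u : E4) : coordMap M a u 2 = u 2 := rfl
/-- Component `φ` of `ι̂`. [folklore] -/
@[simp] theorem coordMap_apply_three (u : E4) : coordMap M a u 3 = -u 3 + angleShift M a (u 1) := rfl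

/-- The underlying linear map of `dι̂`. [folklore] -/
def coordDerivLin (M a r : ℝ) : E4 →ₗ[ℝ] E4 where
  toFun v := !₂[-v 0 + 4 * M * r / delta M a r * v 1, v 1, v 2, -v 3 + 2 * a / delta M a r * v 1]
  map_add' v w := by
    ext i
    fin_cases i <;> simp <;> ring
  map_smul' c v := by
    ext i
    fin_cases i <;> simp <;> ring

/-- **The differential** `dι̂ (v) = (−v⁰ + F'(r) v¹, v¹, v², −v³ + G'(r) v¹)`, `F' = 4Mr/Δ`,
`G' = 2a/Δ`, as a continuous linear map. [folklore] -/
def coordDeriv (M a r : ℝ) : E4 →L[ℝ] E4 :=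
  LinearMap.toContinuousLinearMap (coordDerivLin M a r)

/-- Component `t*` of `dι̂ v`. [folklore] -/
@[simp] theorem coordDeriv_apply_zero (r : ℝ) (v : E4) :
    coordDeriv M a r v 0 = -v 0 + 4 * M * r / delta M a r * v 1 := by
  simp [coordDeriv, coordDerivLin]
/-- Component `r` of `dι̂ v`. [folklore] -/
@[simp] theorem coordDeriv_apply_one (r : ℝ) (v : E4) : coordDeriv M a r v 1 = v 1 := by
  simp [coordDeriv, coordDerivLin]
/-- Component `μ` of `dι̂ v`. [folklore] -/
@[simp] theorem coordDeriv_apply_two (r : ℝ) (v : E4) : coordDeriv M a r v 2 = v 2 := by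
  simp [coordDeriv, coordDerivLin]
/-- Component `φ` of `dι̂ v`. [folklore] -/
@[simp] theorem coordDeriv_apply_three (r : ℝ) (v : E4) :
    coordDeriv M a r v 3 = -v 3 + 2 * a / delta M a r * v 1 := by
  simp [coordDeriv, coordDerivLin]

/-- **Invariance of the Kerr components under `dι̂`** (the heart of the matter): for
`Δ, Σ, 1 − μ² ≠ 0`, `g_u(dι̂ v, dι̂ w) = g_u(v, w)` for the rational component field
`Kerr.Ingoing.bilin` of the Kerr metric in ingoing Kerr coordinates — the identities
`(1 − 2H)P + 2Ha(1 − μ²)Q = 2` and `c₃₃ Q = 2a(1 − μ²)(1 + HP)` with `P = 2(r² + a²)/Δ`, `Q = 2a/Δ`.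
O'Neill 1995, Ch. 3, §3.1 (in Boyer–Lindquist form the metric is even in `(dt, dφ)`).
[cite: ONeill1995, Ch. 3 §3.1] -/
theorem _root_.Literature.Geometry.Lorentzian.Kerr.Ingoing.bilin_coordDeriv {u : E4}
    (hΔ : delta M a (u 1) ≠ 0) (hS : Ingoing.sigma a u ≠ 0) (hs : Ingoing.sinSq u ≠ 0) (v w : E4) :
    Ingoing.bilin M a u (coordDeriv M a (u 1) v) (coordDeriv M a (u 1) w) = Ingoing.bilin M a u v w := by
  rw [Ingoing.bilin_apply, Ingoing.bilin_apply]
  simp only [coordDeriv_apply_zero, coordDeriv_apply_one, coordDeriv_apply_two, coordDeriv_apply_three,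
    Ingoing.c13, Ingoing.c22, Ingoing.c33, Ingoing.h00, Ingoing.h03, Ingoing.scalarH]
  field_simp
  simp only [delta, Ingoing.sigma, Ingoing.sinSq]
  ring

/-- The components depend on `(r, μ)` only. [folklore] -/
theorem _root_.Literature.Geometry.Lorentzian.Kerr.Ingoing.bilin_congr {u u' : E4}
    (h1 : u' 1 = u 1) (h2 : u' 2 = u 2) : Ingoing.bilin M a u' = Ingoing.bilin M a u := by
  ext v w
  simp only [Ingoing.bilin_apply, Ingoing.c13, Ingoing.c22, Ingoing.c33, Ingoing.h00, Ingoing.h03,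
    Ingoing.scalarH, Ingoing.sigma, Ingoing.sinSq, h1, h2]


/-! ## §3 The map in Kerr–Schild Cartesian coordinates -/

/-- Cosine of the total rotation of the `(x, y)`-plane: `C + iS = e^{iG(r)} (r + ia)²/(r² + a²)`.
[folklore] -/
def rotCos (M a r : ℝ) : ℝ :=
  (Real.cos (angleShift M a r) * (r ^ 2 - a ^ 2) - Real.sin (angleShift M a r) * (2 * a * r)) /
    (r ^ 2 + a ^ 2)

/-- Sine of the total rotation of the `(x, y)`-plane: `C + iS = e^{iG(r)} (r + ia)²/(r² + a²)`.
[folklore] -/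
def rotSin (M a r : ℝ) : ℝ :=
  (Real.sin (angleShift M a r) * (r ^ 2 - a ^ 2) + Real.cos (angleShift M a r) * (2 * a * r)) /
    (r ^ 2 + a ^ 2)

/-- `C² + S² = 1` for `r ≠ 0`. [folklore] -/
theorem rotCos_sq_add_rotSin_sq {r : ℝ} (hr : r ≠ 0) : rotCos M a r ^ 2 + rotSin M a r ^ 2 = 1 := by
  have h : r ^ 2 + a ^ 2 ≠ 0 := by positivity
  unfold rotCos rotSin
  field_simp
  linear_combination ((r ^ 2 - a ^ 2) ^ 2 + (2 * a * r) ^ 2) * Real.cos_sq_add_sin_sq (angleShift M a r)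

/-- `C` is smooth on `r > r₊`. [folklore] -/
theorem contDiffAt_rotCos (h : IsSubextremal M a) {r : ℝ} (hr : rPlus M a < r) {n : WithTop ℕ∞} :
    ContDiffAt ℝ n (rotCos M a) r := by
  have hr0 : 0 < r := (h.rMinus_nonneg.trans_lt h.rMinus_lt_rPlus).trans hr
  have hd : r ^ 2 + a ^ 2 ≠ 0 := by positivity
  have hG := contDiffAt_angleShift h hr (n := n)
  unfold rotCos
  refine ContDiffAt.div ?_ (by fun_prop) hd
  exact ((Real.contDiff_cos.contDiffAt.comp r hG).mul (by fun_prop)).sub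
    ((Real.contDiff_sin.contDiffAt.comp r hG).mul (by fun_prop))

/-- `S` is smooth on `r > r₊`. [folklore] -/
theorem contDiffAt_rotSin (h : IsSubextremal M a) {r : ℝ} (hr : rPlus M a < r) {n : WithTop ℕ∞} :
    ContDiffAt ℝ n (rotSin M a) r := by
  have hr0 : 0 < r := (h.rMinus_nonneg.trans_lt h.rMinus_lt_rPlus).trans hr
  have hd : r ^ 2 + a ^ 2 ≠ 0 := by positivity
  have hG := contDiffAt_angleShift h hr (n := n)
  unfold rotSin
  refine ContDiffAt.div ?_ (by fun_prop) hd
  exact ((Real.contDiff_sin.contDiffAt.comp r hG).mul (by fun_prop)).add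
    ((Real.contDiff_cos.contDiffAt.comp r hG).mul (by fun_prop))

/-- **The backwards map in Kerr–Schild Cartesian coordinates**,
`ι(t, x, y, z) = (−t + F(r), C x + S y, S x − C y, z)` with `C + iS = e^{iG(r)}(r + ia)²/(r² + a²)`,
i.e. `x' + iy' = e^{iG(r)}(r + ia)²(x − iy)/(r² + a²)`; `r = Kerr.radius a`. O'Neill 1995, Ch. 3, §3.1
(read in the ingoing Kerr–Schild chart, Ch. 2, §2.5). [cite: ONeill1995, Ch. 3 §3.1] -/
def map (M a : ℝ) (x : E4) : E4 :=
  !₂[-x 0 + timeShift M a (radius a x),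
    rotCos M a (radius a x) * x 1 + rotSin M a (radius a x) * x 2,
    rotSin M a (radius a x) * x 1 - rotCos M a (radius a x) * x 2,
    x 3]

/-- Component `t*` of `ι`. [folklore] -/
@[simp] theorem map_apply_zero (x : E4) : map M a x 0 = -x 0 + timeShift M a (radius a x) := rfl
/-- Component `x` of `ι`. [folklore] -/
@[simp] theorem map_apply_one (x : E4) :
    map M a x 1 = rotCos M a (radius a x) * x 1 + rotSin M a (radius a x) * x 2 := rfl
/-- Component `y` of `ι`. [folklore] -/
@[simp] theorem map_apply_two (x : E4) :
    map M a x 2 = rotSin M a (radius a x) * x 1 - rotCos M a (radius a x) * x 2 := rfl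
/-- Component `z` of `ι`. [folklore] -/
@[simp] theorem map_apply_three (x : E4) : map M a x 3 = x 3 := rfl

/-- `ι` preserves `x² + y²` (it is a rotation–reflection of the `(x, y)`-plane). [folklore] -/
theorem sq_add_sq_map {x : E4} (hx : 0 < radius a x) :
    map M a x 1 ^ 2 + map M a x 2 ^ 2 = x 1 ^ 2 + x 2 ^ 2 := by
  have h := rotCos_sq_add_rotSin_sq (M := M) (a := a) hx.ne'
  simp only [map_apply_one, map_apply_two]
  linear_combination (x 1 ^ 2 + x 2 ^ 2) * h

/-- `ι` preserves the spatial norm. [folklore] -/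
theorem spatialNorm_map {x : E4} (hx : 0 < radius a x) :
    E4.spatialNorm (map M a x) = E4.spatialNorm x := by
  have h1 : E4.spatialNorm (map M a x) ^ 2 = E4.spatialNorm x ^ 2 := by
    rw [E4.spatialNorm_sq, E4.spatialNorm_sq, map_apply_three]
    linear_combination sq_add_sq_map (M := M) hx
  exact (pow_left_inj₀ (E4.spatialNorm_nonneg _) (E4.spatialNorm_nonneg _) two_ne_zero).1 h1

/-- **`ι` preserves the Kerr–Schild radius** (it depends on `‖x⃗‖` and `z` only). [folklore] -/
theorem radius_map {x : E4} (hx : 0 < radius a x) : radius a (map M a x) = radius a x := by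
  simp only [radius, spatialNorm_map hx, map_apply_three]

/-- **`ι` is an involution** on `{r > 0}`. O'Neill 1995, Ch. 3, §3.1. [cite: ONeill1995, Ch. 3 §3.1] -/
theorem map_map {x : E4} (hx : 0 < radius a x) : map M a (map M a x) = x := by
  have hr := radius_map (M := M) hx
  have h := rotCos_sq_add_rotSin_sq (M := M) (a := a) hx.ne'
  ext i
  fin_cases i
  · simp [hr]
  · simp only [Fin.mk_one, map_apply_one, hr, map_apply_two]
    linear_combination x 1 * h
  · simp only [Fin.reduceFinMk, map_apply_two, hr, map_apply_one]
    linear_combination x 2 * h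
  · simp

/-- `ι` preserves the chart domains `Kerr.region a r₀`. [folklore] -/
theorem map_mem_region {r₀ : ℝ} {x : E4} (hx : x ∈ region a r₀) : map M a x ∈ region a r₀ := by
  rw [mem_region, radius_map (radius_pos_of_mem_region hx)]
  exact hx

/-- **`ι` anti-commutes with the stationary flow**: `ι(x + s ∂_{t*}) = ι(x) − s ∂_{t*}`. [folklore] -/
theorem map_add_time (x : E4) (s : ℝ) :
    map M a (x + s • E4.basisVector 0) = map M a x - s • E4.basisVector 0 := by
  have hr := radius_add_time_smul_basisVector a x s
  ext i
  fin_cases i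
  · simp [hr, E4.basisVector]
    ring
  · simp [hr, E4.basisVector]
  · simp [hr, E4.basisVector]
  · simp [E4.basisVector]

/-- **`ι` is `C^∞` on the exterior** of a sub-extremal hole. [folklore] -/
theorem contDiffAt_map (h : IsSubextremal M a) {x : E4} (hx : rPlus M a < radius a x) {n : WithTop ℕ∞} :
    ContDiffAt ℝ n (map M a) x := by
  have hr0 : 0 < radius a x := (h.rMinus_nonneg.trans_lt h.rMinus_lt_rPlus).trans hx
  have hr : ContDiffAt ℝ n (radius a) x := contDiffAt_radius hr0
  have hc : ∀ i, ContDiff ℝ n fun w : E4 ↦ w i := fun i ↦ contDiff_euclidean.1 contDiff_id i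
  have hF : ContDiffAt ℝ n (fun y ↦ timeShift M a (radius a y)) x := (contDiffAt_timeShift h hx).comp x hr
  have hC : ContDiffAt ℝ n (fun y ↦ rotCos M a (radius a y)) x := (contDiffAt_rotCos h hx).comp x hr
  have hS : ContDiffAt ℝ n (fun y ↦ rotSin M a (radius a y)) x := (contDiffAt_rotSin h hx).comp x hr
  rw [contDiffAt_euclidean]
  intro i
  fin_cases i
  · simp only [Fin.zero_eta, Fin.isValue, map_apply_zero]
    exact (hc 0).contDiffAt.neg.add hF
  · simp only [Fin.mk_one, Fin.isValue, map_apply_one]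
    exact (hC.mul (hc 1).contDiffAt).add (hS.mul (hc 2).contDiffAt)
  · simp only [Fin.reduceFinMk, Fin.isValue, map_apply_two]
    exact (hS.mul (hc 1).contDiffAt).sub (hC.mul (hc 2).contDiffAt)
  · simp only [Fin.reduceFinMk, Fin.isValue, map_apply_three]
    exact (hc 3).contDiffAt

/-- `ι` is `C^∞` on the exterior, as a `ContDiffOn` statement. [folklore] -/
theorem contDiffOn_map (h : IsSubextremal M a) {n : WithTop ℕ∞} :
    ContDiffOn ℝ n (map M a) (exterior M a) := fun _ hx ↦
  (contDiffAt_map h (lt_of_le_of_lt (le_max_left _ _) (mem_exterior.1 hx))).contDiffWithinAt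

/-- `dι(∂_{t*}) = −∂_{t*}` wherever `ι` is differentiable. [folklore] -/
theorem fderiv_map_basisVector_zero {x : E4} (hd : DifferentiableAt ℝ (map M a) x) :
    fderiv ℝ (map M a) x (E4.basisVector 0) = -E4.basisVector 0 := by
  have h1 : HasDerivAt (fun s : ℝ ↦ map M a (x + s • E4.basisVector 0))
      (fderiv ℝ (map M a) x (E4.basisVector 0)) 0 := by
    have hl : HasDerivAt (fun s : ℝ ↦ x + s • E4.basisVector 0) (E4.basisVector 0) 0 := by
      simpa using ((hasDerivAt_id (0 : ℝ)).smul_const (E4.basisVector 0)).const_add x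
    have hm : HasFDerivAt (map M a) (fderiv ℝ (map M a) x) (x + (0 : ℝ) • E4.basisVector 0) := by
      simpa using hd.hasFDerivAt
    exact hm.comp_hasDerivAt (0 : ℝ) hl
  have h2 : HasDerivAt (fun s : ℝ ↦ map M a (x + s • E4.basisVector 0)) (-E4.basisVector 0) 0 := by
    have : (fun s : ℝ ↦ map M a (x + s • E4.basisVector 0)) = fun s ↦ map M a x - s • E4.basisVector 0 :=
      funext fun s ↦ map_add_time x s
    rw [this]
    simpa using ((hasDerivAt_id (0 : ℝ)).smul_const (E4.basisVector 0)).const_sub (map M a x)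
  exact h1.unique h2

/-! ## §4 The chart intertwines `ι̂` and `ι` -/

/-- `ι̂` preserves the coordinate domain. [folklore] -/
theorem coordMap_mem_coordDomain {r₀ : ℝ} {u : E4} (hu : u ∈ Ingoing.coordDomain r₀) :
    coordMap M a u ∈ Ingoing.coordDomain r₀ := by
  rw [Ingoing.mem_coordDomain] at hu ⊢
  simpa using hu

/-- **The chart intertwines the two maps**: `ι(Ψ u) = Ψ(ι̂ u)` on the coordinate domain —
`e^{iG}(r + ia)²/(r² + a²) · (r − ia) sin ϑ e^{−iφ} = (r + ia) sin ϑ e^{i(G − φ)}`. [folklore] -/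
theorem map_chartFun {r₀ : ℝ} {u : E4} (hu : u ∈ Ingoing.coordDomain r₀) :
    map M a (Ingoing.chartFun a r₀ u) = Ingoing.chartFun a r₀ (coordMap M a u) := by
  have hu' := coordMap_mem_coordDomain (M := M) (a := a) hu
  have hr : radius a (Ingoing.chartFun a r₀ u) = u 1 := by
    rw [Ingoing.radius_chartFun, Ingoing.radialParam_of_lt hu.1]
  have hr0 : (u 1) ^ 2 + a ^ 2 ≠ 0 := by
    have := Ingoing.radial_pos hu
    positivity
  have e1 : ∀ (t : ℝ) (y : E3), E4.ofTimeSpace t y 1 = y 0 := fun t y ↦ E4.ofTimeSpace_apply_succ t y 0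
  have e2 : ∀ (t : ℝ) (y : E3), E4.ofTimeSpace t y 2 = y 1 := fun t y ↦ E4.ofTimeSpace_apply_succ t y 1
  have e3 : ∀ (t : ℝ) (y : E3), E4.ofTimeSpace t y 3 = y 2 := fun t y ↦ E4.ofTimeSpace_apply_succ t y 2
  rw [Ingoing.chartFun_eq hu, Ingoing.chartFun_eq hu'] at *
  ext i
  fin_cases i
  · simp [hr]
  · simp only [Fin.mk_one, Fin.isValue, map_apply_one, hr, coordMap_apply_zero, coordMap_apply_one,
      coordMap_apply_two, coordMap_apply_three, e1, e2, kerrStar_apply_zero, kerrStar_apply_one,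
      Real.cos_add, Real.sin_add, Real.cos_neg, Real.sin_neg, rotCos, rotSin]
    field_simp
    ring
  · simp only [Fin.reduceFinMk, Fin.isValue, map_apply_two, hr, coordMap_apply_zero, coordMap_apply_one,
      coordMap_apply_two, coordMap_apply_three, e1, e2, kerrStar_apply_zero, kerrStar_apply_one,
      Real.cos_add, Real.sin_add, Real.cos_neg, Real.sin_neg, rotCos, rotSin]
    field_simp
    ring
  · simp only [Fin.reduceFinMk, Fin.isValue, map_apply_three, e3, kerrStar_apply_two, coordMap_apply_one,
      coordMap_apply_two]

/-- `ι̂` is differentiable on the coordinate domain of the exterior, with differential `dι̂`. [folklore] -/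
theorem hasFDerivAt_coordMap (h : IsSubextremal M a) {u : E4} (hu : rPlus M a < u 1) :
    HasFDerivAt (coordMap M a) (coordDeriv M a (u 1)) u := by
  have h1 : HasFDerivAt (fun w : E4 ↦ w 1) (E4.dx 1) u := (E4.dx 1).hasFDerivAt
  have hF : HasFDerivAt (timeShift M a ∘ fun w : E4 ↦ w 1) ((4 * M * u 1 / delta M a (u 1)) • E4.dx 1) u :=
    (hasDerivAt_timeShift h hu).comp_hasFDerivAt u h1
  have hG : HasFDerivAt (angleShift M a ∘ fun w : E4 ↦ w 1) ((2 * a / delta M a (u 1)) • E4.dx 1) u :=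
    (hasDerivAt_angleShift h hu).comp_hasFDerivAt u h1
  have key : HasFDerivAt (coordMap M a) (coordDeriv M a (u 1)) u ↔
      ∀ i, HasFDerivAt (fun w ↦ coordMap M a w i) ((EuclideanSpace.proj i).comp (coordDeriv M a (u 1))) u := by
    rw [← hasFDerivWithinAt_univ, hasFDerivWithinAt_euclidean]
    simp only [hasFDerivWithinAt_univ]
  rw [key]
  intro i
  fin_cases i
  · simp only [Fin.zero_eta, Fin.isValue, coordMap_apply_zero]
    refine (((E4.dx 0).hasFDerivAt).neg.add hF).congr_fderiv ?_
    ext v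
    simp [E4.dx]
  · simp only [Fin.mk_one, Fin.isValue, coordMap_apply_one]
    refine ((E4.dx 1).hasFDerivAt).congr_fderiv ?_
    ext v
    simp [E4.dx]
  · simp only [Fin.reduceFinMk, Fin.isValue, coordMap_apply_two]
    refine ((E4.dx 2).hasFDerivAt).congr_fderiv ?_
    ext v
    simp [E4.dx]
  · simp only [Fin.reduceFinMk, Fin.isValue, coordMap_apply_three]
    refine (((E4.dx 3).hasFDerivAt).neg.add hG).congr_fderiv ?_
    ext v
    simp [E4.dx]


/-! ## §5 The isometry identity in the Kerr–Schild chart -/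

/-- **Off the axis, `ι` is an isometry of the Kerr–Schild form**: transport of
`Kerr.Ingoing.bilin_coordDeriv` through the chart `Ψ` (whose Jacobian is bijective on the
coordinate domain), using `ι ∘ Ψ = Ψ ∘ ι̂` near `u` and `g_{Ψu}(J v, J w) = ĝ_u(v, w)`.
O'Neill 1995, Ch. 3, §3.1. [cite: ONeill1995, Ch. 3 §3.1] -/
theorem bilin_fderiv_map_of_offAxis (h : IsSubextremal M a) {x : E4} (hx : x ∈ exterior M a)
    (hax : x 1 ≠ 0 ∨ x 2 ≠ 0) (v w : E4) :
    Kerr.bilin M a (map M a x) (fderiv ℝ (map M a) x v) (fderiv ℝ (map M a) x w) = Kerr.bilin M a x v w := by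
  have hx' : x ∈ region a (rPlus M a) := hx
  obtain ⟨u, hu, rfl⟩ := Ingoing.exists_chartFun_eq hx' hax
  have hu1 : rPlus M a < u 1 := lt_of_le_of_lt (le_max_left _ _) hu.1
  have hu' := coordMap_mem_coordDomain (M := M) (a := a) hu
  have hΔ : delta M a (u 1) ≠ 0 := (delta_pos h.le hu1).ne'
  have hS : Ingoing.sigma a u ≠ 0 := Ingoing.sigma_ne_zero hu
  have hs : Ingoing.sinSq u ≠ 0 := Ingoing.sinSq_ne_zero hu
  have hxr : rPlus M a < radius a (Ingoing.chartFun a (rPlus M a) u) := by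
    rw [Ingoing.radius_chartFun, Ingoing.radialParam_of_lt hu.1]; exact hu1
  have hmd : DifferentiableAt ℝ (map M a) (Ingoing.chartFun a (rPlus M a) u) :=
    (contDiffAt_map h hxr (n := 1)).differentiableAt one_ne_zero
  -- the two chain rules and the local intertwining `ι ∘ Ψ = Ψ ∘ ι̂`
  have hc1 : fderiv ℝ (map M a ∘ Ingoing.chartFun a (rPlus M a)) u =
      (fderiv ℝ (map M a) (Ingoing.chartFun a (rPlus M a) u)).comp (Ingoing.jac a u) := by
    rw [fderiv_comp u hmd (Ingoing.differentiableAt_chartFun hu), Ingoing.fderiv_chartFun hu]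
  have hc2 : fderiv ℝ (Ingoing.chartFun a (rPlus M a) ∘ coordMap M a) u =
      (Ingoing.jac a (coordMap M a u)).comp (coordDeriv M a (u 1)) :=
    ((Ingoing.hasFDerivAt_chartFun hu').comp u (hasFDerivAt_coordMap h hu1)).fderiv
  have heq : map M a ∘ Ingoing.chartFun a (rPlus M a) =ᶠ[𝓝 u] Ingoing.chartFun a (rPlus M a) ∘ coordMap M a :=
    Filter.eventually_of_mem ((Ingoing.coordDomain (rPlus M a)).isOpen.mem_nhds hu)
      fun u' hu' ↦ map_chartFun hu'
  have hD : (fderiv ℝ (map M a) (Ingoing.chartFun a (rPlus M a) u)).comp (Ingoing.jac a u) =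
      (Ingoing.jac a (coordMap M a u)).comp (coordDeriv M a (u 1)) := by
    rw [← hc1, heq.fderiv_eq, hc2]
  -- the Jacobian is onto, so it suffices to test on `J v'`, `J w'`
  have hsurj : Function.Surjective (Ingoing.jac a u) :=
    (LinearMap.injective_iff_surjective (f := (Ingoing.jac a u : E4 →ₗ[ℝ] E4))).1 (Ingoing.jac_injective hu)
  obtain ⟨v', rfl⟩ := hsurj v
  obtain ⟨w', rfl⟩ := hsurj w
  have hDv : fderiv ℝ (map M a) (Ingoing.chartFun a (rPlus M a) u) (Ingoing.jac a u v') =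
      Ingoing.jac a (coordMap M a u) (coordDeriv M a (u 1) v') := DFunLike.congr_fun hD v'
  have hDw : fderiv ℝ (map M a) (Ingoing.chartFun a (rPlus M a) u) (Ingoing.jac a u w') =
      Ingoing.jac a (coordMap M a u) (coordDeriv M a (u 1) w') := DFunLike.congr_fun hD w'
  rw [hDv, hDw, map_chartFun hu, Ingoing.kerrBilin_jac hu', Ingoing.kerrBilin_jac hu,
    Ingoing.bilin_congr (M := M) (a := a) (coordMap_apply_one (M := M) (a := a) u) (coordMap_apply_two u),
    Ingoing.bilin_coordDeriv hΔ hS hs]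

/-- **`ι` is an isometry of the Kerr–Schild form on the whole exterior**:
`g_{ιx}(dι v, dι w) = g_x(v, w)`; the axis points follow by continuity (`Kerr.eqOn_region_of_offAxis`).
O'Neill 1995, Ch. 3, §3.1. [cite: ONeill1995, Ch. 3 §3.1] -/
theorem bilin_fderiv_map (h : IsSubextremal M a) {x : E4} (hx : x ∈ exterior M a) (v w : E4) :
    Kerr.bilin M a (map M a x) (fderiv ℝ (map M a) x v) (fderiv ℝ (map M a) x w) = Kerr.bilin M a x v w := by
  have hr : ∀ y ∈ exterior M a, rPlus M a < radius a y := fun y hy ↦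
    lt_of_le_of_lt (le_max_left _ _) (mem_exterior.1 hy)
  have hD : ContinuousOn (fun y ↦ fderiv ℝ (map M a) y) (exterior M a) :=
    (contDiffOn_map h (n := 1)).continuousOn_fderiv_of_isOpen (exterior M a).isOpen le_rfl
  have hB : ContinuousOn (fun y ↦ Kerr.bilin M a (map M a y)) (exterior M a) := fun y hy ↦
    ((contDiffAt_bilin M a (radius_pos_of_mem_region (map_mem_region (M := M) hy)) (n := 0)).continuousAt.comp
      (contDiffAt_map h (hr y hy) (n := 0)).continuousAt).continuousWithinAt
  have hB₀ : ContinuousOn (fun y ↦ Kerr.bilin M a y) (exterior M a) := fun y hy ↦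
    (contDiffAt_bilin M a (radius_pos_of_mem_region hy) (n := 0)).continuousAt.continuousWithinAt
  have hcont : ContinuousOn (fun y ↦ Kerr.bilin M a (map M a y) (fderiv ℝ (map M a) y v) (fderiv ℝ (map M a) y w) -
      Kerr.bilin M a y v w) (exterior M a) :=
    ((hB.clm_apply (hD.clm_apply continuousOn_const)).clm_apply (hD.clm_apply continuousOn_const)).sub
      ((hB₀.clm_apply continuousOn_const).clm_apply continuousOn_const)
  have key := eqOn_region_of_offAxis (a := a) (r₀ := rPlus M a) (c := (0 : ℝ)) hcont
    (fun y hy hax ↦ sub_eq_zero.2 (bilin_fderiv_map_of_offAxis h hy hax v w)) x hx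
  exact sub_eq_zero.1 key

/-! ## §6 The backwards isometry of the Kerr exterior: discharge of the named fact -/

/-- **The backwards isometry** `ι` as a self-map of the Kerr exterior chart `Kerr.exterior M a`.
O'Neill 1995, Ch. 3, §3.1. [cite: ONeill1995, Ch. 3 §3.1] -/
def exteriorMap (M a : ℝ) (x : region a (rPlus M a)) : region a (rPlus M a) :=
  ⟨map M a x, map_mem_region x.2⟩

/-- The isometry in coordinates. [folklore] -/
@[simp] theorem coe_exteriorMap (x : region a (rPlus M a)) : (exteriorMap M a x : E4) = map M a x := rfl

/-- **`ι` is an involution of the exterior.** O'Neill 1995, Ch. 3, §3.1. [cite: ONeill1995, Ch. 3 §3.1] -/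
theorem exteriorMap_exteriorMap (x : region a (rPlus M a)) : exteriorMap M a (exteriorMap M a x) = x :=
  Subtype.ext (map_map (radius_pos_of_mem_region x.2))

/-- **`ι` is `C^∞`** as a map of the open submanifold `Kerr.exterior M a`. [folklore] -/
theorem contMDiff_exteriorMap (h : IsSubextremal M a) :
    ContMDiff 𝓘(ℝ, E4) 𝓘(ℝ, E4) ∞ (exteriorMap M a) := by
  intro x
  rw [← ContMDiffAt.subtypeVal_comp_iff,
    OpensChart.contMDiffAt_iff x (Subtype.val ∘ exteriorMap M a) (map M a) (fun _ ↦ rfl)]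
  exact contDiffAt_map h (lt_of_le_of_lt (le_max_left _ _) (mem_region.1 x.2))

/-- **The manifold derivative of `ι` is the Fréchet derivative of its coordinate expression.**
[folklore] -/
theorem mfderiv_exteriorMap (h : IsSubextremal M a) (x : region a (rPlus M a)) :
    mfderiv 𝓘(ℝ, E4) 𝓘(ℝ, E4) (exteriorMap M a) x = fderiv ℝ (map M a) x := by
  have hd : DifferentiableAt ℝ (map M a) x :=
    (contDiffAt_map h (lt_of_le_of_lt (le_max_left _ _) (mem_region.1 x.2)) (n := 1)).differentiableAt one_ne_zero
  have hmd : MDifferentiableAt 𝓘(ℝ, E4) 𝓘(ℝ, E4) (Subtype.val ∘ exteriorMap M a) x :=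
    (OpensChart.mdifferentiableAt_iff x _ (map M a) (fun _ ↦ rfl)).2 hd
  have e1 := OpensChart.mfderiv_codRestrict (f := Subtype.val ∘ exteriorMap M a) (φ := exteriorMap M a)
    (fun _ ↦ rfl) hmd
  have e2 := OpensChart.mfderiv_eq x (Subtype.val ∘ exteriorMap M a) (map M a) (fun _ ↦ rfl) hd
  exact e1.trans e2

/-- **`ι` is an isometric immersion of the smooth Kerr exterior metric to itself.**
O'Neill 1995, Ch. 3, §3.1. [cite: ONeill1995, Ch. 3 §3.1] -/
theorem isIsometricImmersion_exteriorMap [Facts] (h : IsSubextremal M a) :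
    PseudoRiemannianMetric.IsIsometricImmersion
      (smoothMetric M a (rPlus M a)).toPseudoRiemannianMetric
      (smoothMetric M a (rPlus M a)).toPseudoRiemannianMetric (exteriorMap M a) := by
  refine ⟨contMDiff_exteriorMap h, fun y ↦ ?_⟩
  ext v w
  rw [pullbackBilin_apply, mfderiv_exteriorMap h]
  exact bilin_fderiv_map h y.2 v w

/-- **`ι` reverses the stationary Killing field**: `dι(∂_{t*}) = −∂_{t*}`. O'Neill 1995, §3.7
(`sg(β) = (+1, −1)`). [cite: ONeill1995, Ch. 3 §3.7] -/
theorem mfderiv_exteriorMap_stationaryField (h : IsSubextremal M a) (x : region a (rPlus M a)) :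
    mfderiv 𝓘(ℝ, E4) 𝓘(ℝ, E4) (exteriorMap M a) x (stationaryField a (rPlus M a) x) =
      -(stationaryField a (rPlus M a) (exteriorMap M a x)) := by
  have hd : DifferentiableAt ℝ (map M a) x :=
    (contDiffAt_map h (lt_of_le_of_lt (le_max_left _ _) (mem_region.1 x.2)) (n := 1)).differentiableAt one_ne_zero
  rw [mfderiv_exteriorMap h]
  exact fderiv_map_basisVector_zero hd

end Backwards

end Kerr

/-- **Discharge of the named fact `ONeill1995_kerrBackwardsIsometry`** (O'Neill 1995, Ch. 3, §3.1:
the backwards isometry of the Kerr exterior block): for sub-extremal `(M, a)` the explicit map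
`Kerr.Backwards.exteriorMap M a` of the ingoing Kerr–Schild exterior chart is an involution, an
isometric immersion of `Kerr.smoothMetric M a r₊` to itself, and reverses `∂_{t*}`.
[cite: ONeill1995, Ch. 3 §3.1 (backwards isometry β) with Ch. 2 §2.1 Remark 4 and §3.7] -/
theorem ONeill1995_kerrBackwardsIsometry_holds : ONeill1995_kerrBackwardsIsometry := by
  intro _ M a h
  exact ⟨Kerr.Backwards.exteriorMap M a, Kerr.Backwards.exteriorMap_exteriorMap,
    Kerr.Backwards.isIsometricImmersion_exteriorMap h,
    Kerr.Backwards.mfderiv_exteriorMap_stationaryField h⟩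


end Literature.Geometry.Lorentzian

end
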